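import Mathlib
import HarnessLib
import HarnessLib.Audit
import Summits.ABC.Statement
import Summits.ABC.ABC.Theorems.PlacewiseSzpiroPayoff
import Literature.NumberTheory.DiophantineGeometry.SubexponentialAbcWithoutRadA
import Summits.ABC.ABC.Theorems.SubexponentialAbcWithoutRadAHolds
import HarnessLib.Audit.Status.Attr

/-!
Route: AntisymmetricTwoTorsion

# Route AntisymmetricTwoTorsion — Subexponential Szpiro up to a trace defect on the antisymmetric
two-torsion class via rad(a)-free abc

D-0145 ideator LINE (abc-idea-1 g2, technique card «dictionary import with an explicit checkable
dictionary»). NO SUMMIT IS PROVED BY A LINE; typed ≠ proved; the rung A1′ `SubexponentialSzpiro` is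
NOT abc and NOT A-PS, and this line does NOT prove A1′ either: it proves A1′ UP TO A TRACE DEFECT on
a class. It suffices to show X = X_class ∧ X_res with X_class = `TraceDefectSubexpSzpiro`: for every
curve W_{a,b} : y² = x(x² + a x + b) with gcd(a,b) = 1, b(a² − 4b) ≠ 0 and NOT (b > 0 ∧ a² − 4b > 0)
— the ANTISYMMETRIC-SIGN half of the 2-torsion family, where a² is a summand, not the sum, of the
coprime triple {a², |a² − 4b|, 4|b|} — one has `log|Δ_min(W)| ≤ 12·log(1 + |a|) + C(ε)·N_W^ε`:
Szpiro's discriminant is subexponential in the conductor up to a power of the trace coefficient a =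
−(e₊ + e₋) (so on the lopsided sub-class |a| ≤ N^δ it IS the rung's inequality `log|Δ| ≪
N^(12δ+ε)`); and X_res = `OffClassResidual`, the rung A1′ given X_class — a DECLARED RESIDUAL of
rung strength, NOT claimed. X_class is the explicit-dictionary image of ONE literature theorem,
Pasten–Sepúlveda-Manzo 2025 Thm 2.2 (`abc` without rad(a)): the radical it omits is exactly the
radical of the good-reduction coefficient a.
Lean: `Summit.ABC.ABC.Theses.AntisymmetricTwoTorsion.TraceDefectSubexpSzpiro ∧
Summit.ABC.ABC.Theses.AntisymmetricTwoTorsion.OffClassResidual`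

## Assembly
Pure logic: `closes (h₁ : RadAFreeEngine) (h₂ : TwoTorsionDictionary) (h₃ : TraceDefectPayoff) (h₄ :
OffClassResidual) : Summit.ABC.Harvest.SubexponentialSzpiro := h₄ (h₃ h₁ h₂)` (glue2.lean,
closes_target A1p). The mathematical content is h₃ h₁ h₂ : TraceDefectSubexpSzpiro; h₄ is the
declared residual.

CLOSES_TARGET: closes rung ABC-A1' (PROPOSED) of ABC: Summit.ABC.Harvest.SubexponentialSzpiro (D-0061; not the summit Statement) — the deciding theorem of this route concludes that registered leaf instead of the Statement decl `ABC` (class rung: servable and labelled, never counted as concluding the summit Statement).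

Rationale: WHY THIS LINE. DICTIONARY (explicit, checkable): W_{a,b} ↦ the coprime triple a² + (4b − a²) = 4b (b
> 0 > a² − 4b; divide by 4 when a is even) or a² + 4|b| = a² − 4b (b < 0): in both admissible sign
cases a² is a SUMMAND, Δ(W_{a,b}) = 16 b²(a² − 4b) has |Δ| ≤ 64·M³ with M = max(4|b|, |a² − 4b|) the
largest member, and rad of the two OTHER members divides 2·N_W (Tate's algorithm away from 2: the
odd primes of b(a² − 4b) are multiplicative, the model being minimal there). IMPORT (transcendence,
2025): Pasten–Sepúlveda-Manzo, arXiv:2406.05083 = Bull. Braz. Math. Soc. 56 (2025), Thm 2.2 — for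
ALL coprime a + b = c, `log(c/a)/log⁎₂ c ≤ exp(κ·psRate(rad(bc)))`, rad(a) absent — typed in the
tree as the named fact `PastenSepulvedaManzo2025_thm_2_2` and PROVED there from Evertse–Győry Thm
4.2.1 (`PastenSepulvedaManzo2025_thm_2_2_of_evertseGyory`) and from the rung A1.L
(`…_of_approximationBound`). Applied with the omitted member a²: log(M/a²) ≤ log⁎₂M · exp(κ
psRate(2N)), whence log M ≤ 4 log|a| + C(ε) N^ε and log|Δ_min| ≤ 3 log M + log 64. WHAT IT DOES THAT
PRIOR ROUTES DO NOT: YuMatveevShapeRat lists the 2025 theorem among its library clients but no route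
points it at Szpiro; LopsidedSzpiroSplit (dormant) splits abc triples at the power scale and needs
sextic Szpiro for the Frey 2-isogeny codomain — full rational 2-torsion, rad(c) present;
PlacewiseSzpiro attacks A1′ tower by tower for all E. Here the omitted radical is identified with
the GOOD-REDUCTION part of a curve with ONE rational 2-torsion point, which turns a four-page abc
theorem into a Szpiro-type theorem on half of the two-parameter 2-torsion family. Nearest print:
Cuevas Barrientos–Pasten arXiv:2504.15971 Cor 1.2 (subexponential Szpiro in ONE-parameter families —
different method: modular degree + valuation products); this class is two-parameter and the
statement is uniform in both parameters up to the explicit defect 12 log(1+|a|).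

RANKED CRUXES. #0 TraceDefectSubexpSzpiro (target) — SUBEXPONENTIAL SZPIRO UP TO A TRACE DEFECT on
the antisymmetric two-torsion class: for every ε > 0 there is C such that for all coprime a, b with
b(a² − 4b) ≠ 0, not (b > 0 and a² − 4b > 0), and every elliptic W = ⟨0,a,0,b,0⟩: log|Δ_min(W)| ≤
12·log(1 + |a|) + C·N_W^ε. (why it might fail: the constant 12 (from absorbing log⁎₂ c and the
factor 4 when a is even) could need to be larger — a misstatement risk, repaired by any fixed
constant; the sign restriction is essential (for b > 0 < a² − 4b, a² is the sum and rad(a) cannot be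
omitted: 2^k + 3^j).) [arXiv:2406.05083, EvertseGyory2015]
#2 TraceDefectPayoff (crux) — PAYOFF: the rad(a)-free engine (Thm 2.2) and the two-torsion
dictionary give the trace-defect bound — apply Thm 2.2 to the coprime triple with omitted member a²
(a'² = a²/4 when a is even), largest member M or M/4; absorb log⁎₂ via L ≤ 2 log|a| + E·max(1, log
L) ⇒ L ≤ 4 log|a| + 4E log(4E); exp(κ psRate(R)) ≤ C(ε) R^ε; R ≤ 2N; |Δ_min| ≤ |Δ| ≤ 64 M³; the two
curves with a = 0 (b = ±1) absorbed into C. [deps: RadAFreeEngine, TwoTorsionDictionary]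
[difficulty: M] (why it might fail: bookkeeping only: psRate is not monotone near R = e^e and Thm
2.2 divides by log⁎₂ c, so the absorption constants must be tracked; if 12 is too small the target
is restated with a larger absolute constant (the shape survives).) [arXiv:2406.05083, Silverman2009]
#3 OffClassResidual (crux) — DECLARED RESIDUAL (rung-strength, NOT claimed, exempt from T3/T4): the
rung A1′ given the class theorem — i.e. subexponential Szpiro off the antisymmetric class, and on it
the removal of the trace defect 12 log(1+|a|). [deps: TraceDefectSubexpSzpiro] [difficulty:
open-problem] (why it might fail: it is the open rung A1′ itself outside (and, for the defect,
inside) a thin class; no claim; kept as the honest complement of the conjunct this line attacks.)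
[PastenShimura2024, arXiv:2504.15971]
#9 RadAFreeEngine (support) — ENGINE (Pasten–Sepúlveda-Manzo 2025 Thm 2.2, named fact in the tree,
proved there from Evertse–Győry Thm 4.2.1 and from rung A1.L): there is κ > 0 with log(c/a)/log⁎₂ c
≤ exp(κ·psRate(rad(bc))) for all coprime a + b = c. [difficulty: M] [arXiv:2406.05083,
EvertseGyory2015]
#9 TwoTorsionDictionary (support) — TWO-TORSION DICTIONARY (Tate's algorithm away from 2): for
coprime a, b with b(a² − 4b) ≠ 0 and W = ⟨0,a,0,b,0⟩ elliptic, |Δ_min(W)| ≤ |16 b²(a² − 4b)| and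
rad(b(a² − 4b)) divides 2·N_W. [difficulty: M] [Silverman2009, BennettSkinner2004]

TWO-LAYER PLAN. TraceDefectPayoff ⇐ TripleReduction → DefectAbsorption → TraceDefectPayoff
(TripleReduction: the sign-case analysis producing an `IsABCTriple` with first member a² or a²/4 and
rad of the other two dividing 2N; DefectAbsorption: the real-analysis step L ≤ 2 log|a| + E log⁎ L ⇒
L ≤ 4 log|a| + 4E log 4E and exp(κ psRate R) ≤ C(ε) R^ε). COROLLARY foreseen (not filed): on the
lopsided sub-class a²·exp((log M)^τ log⁎₂ M) ≤ M, Thm 1.3 gives log|Δ_min| ≤ C(τ,ε) N^ε outright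
(A1′ verbatim on that sub-class).

KILL CRITERIA. TraceDefectSubexpSzpiro refuted as typed (a family in the sign class with log|Δ_min|
− 12 log(1+|a|) ≫ N^δ) would contradict Thm 2.2 + the dictionary, so it can only come from a
misstatement (constant 12, p = 2): restate, not pivot. The route is moot if A1′ is proved for all E
(superseded) and pointless if the named fact Thm 2.2 were withdrawn in print (it is proved in the
tree from Evertse–Győry 4.2.1, itself a named fact; rung A1.L discharges it).

NOT DECOMPOSED YET. The complementary sign class (b > 0 < a² − 4b: a² is the SUM, two real 2-torsion
abscissae of the same sign) is NOT covered and cannot be by this engine (omitting the radical of the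
sum is false over ℚ: 2^k + 3^j); the removal of the trace defect is the residual; the lopsided
corollary via Thm 1.3 is layer 2.

CHEAPEST FALSIFIER. A lookup, already done: the engine is `PastenSepulvedaManzo2025_thm_2_2`, PROVED
in the tree from `evertseGyory_thm_4_2_1_rat` (SubexponentialAbcWithoutRadAProofs.lean:379) — so the
only killable content is the dictionary at p = 2 and the constant 12: check on the instrument row
«abc-harv E-tables / LMFDB curves with a 2-torsion point, Δ < 0 or a₄ < 0 in the ⟨0,a,0,b,0⟩ model,
gcd(a,b)=1»: plot log|Δ_min| − 12 log(1+|a|) against log N; any linear-in-N growth kills the typed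
constant. Not run this session (critic's first check; expected flat by Thm 2.2).

NUMBERS. All E/ℚ: ε-shape exponent α = 1 (Murty–Pasten 2013). One-parameter families: log|Δ| ≤
exp(κ√(log N log⁎₂N)) (Cuevas Barrientos–Pasten 2025). Engine rate: exp(κ (log⁎₃R/log⁎₂R) log R) =
R^(o(1)) (Pasten–Sepúlveda-Manzo 2025 Thm 2.2). This line: log|Δ_min| ≤ 12 log(1+|a|) + C(ε) N^ε on
the antisymmetric class.

DEFINITION REQUESTS. None (model inlined as `⟨0, a, 0, b, 0⟩ : WeierstrassCurve ℚ`; `Dioph.logStar`,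
`psRate`, `PastenSepulvedaManzo2025_thm_2_2` exist).

Novelty: Searches (2026-08-27): lit search --hybrid "Szpiro conjecture elliptic curve rational 2-torsion
point discriminant conductor bound linear forms in logarithms" (8 docs, none on 2-torsion classes);
lit vsearch "abc/Szpiro inequality for curves with a point of order two via S-unit equations" (8,
none); lit galaxy search "without rad(a)|abcd conjecture|Sepulveda-Manzo" --star all (1 hit, noise:
Princeton Companion), "Szpiro|2-torsion point" --star pdf (8, noise), "unit equation|Gaussian
integers abc" --star pdf ([galaxy:pdf:7635303352151822420] Pasten arXiv:2312.03566); tree: rg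
PastenSepulvedaManzo (typed + proved from EG 4.2.1; consumers: YuMatveevShapeRat rationale only),
SubexponentialSzpiroFamilies.lean (Cuevas Barrientos–Pasten typed),
TernaryFreyCurvesSignatureNN2.lean (Bennett–Skinner curves E₁ = ⟨0,2cC,0,BCbⁿ,0⟩, conductor Lemma
2.1(b) not typed).
Nearest prior art found: arXiv:2406.05083 Thm 2.2/1.3 (the engine; its own application is the abcd
equation, Thm 1.6); arXiv:2504.15971 Cor 1.2 (one-parameter families, modular method);
BennettSkinner2004 Lemma 2.1 (same curves as (n,n,2) Frey curves; conductor formula);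
route-ABC-LopsidedSzpiroSplit (lopsided abc + sextic Szpiro, full 2-torsion).
Delta: identifying the radical omitted by the 2025 rad(a)-free abc theorem with the good-reduction
coefficient of a curve with one rational 2-torsion point, which converts it into a Szpiro-type
theorem (subexponential up to an explicit trace defect) on half of the two-parameter 2-tors  [refs: 2312.03566, 2406.05083, 2504.15971, BennettSkinner2004]

Barriers (technique_class: linear-forms-in-logs, rad-a-free-abc, dictionary): - technique_class: linear-forms-in-logs, rad-a-free-abc, dictionary
- Literature.Barriers.ABC.BakerMethodBounds: INSIDE the Baker class and not beaten — the engine is a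
logarithmic-forms theorem and the target is subexponential (R^(o(1)) in the exponent scale
`log|Δ|`), exactly what the barrier allows; the line can never reach A-PS or abc and says so.
- Literature.Barriers.ABC.SzpiroEpsilonCannotBeDropped: evaded — `+ε`/free constant form only (N^ε
with C(ε)); no exact exponent asserted.
- Literature.Barriers.ABC.EpsilonCannotBeDropped: evaded — no ε-free abc form asserted; the
complementary sign class, where an ε-free-type omission of rad(sum) would be needed, is explicitly
excluded (2^k + 3^j).
- Negatives index: 2 refuted statements (BelyiSqueeze) — unrelated; nothing here restates them.

sub-problem: ABC · status: draft · opened planner-abc-idea-1-g2-0 2026-08-27T23:12:39Z · rev 0 · ledger route-ABC-AntisymmetricTwoTorsion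
GENERATED by the gate from the ledger (D-0016/17). Provers cite these decls: `theorem foo : Summit.ABC.ABC.Theses.AntisymmetricTwoTorsion.<Decl> := …` in Summits/ABC/ABC/Theorems/<Name>.lean.
-/

namespace Summit.ABC.ABC.Theses.AntisymmetricTwoTorsion

open scoped BigOperators Topology Manifold Classical MeasureTheory ProbabilityTheory Matrix InnerProductSpace ComplexConjugate ContinuousMap
open Filter Set Function TopologicalSpace MeasureTheory

attribute [summit_statement] _root_.ABC
attribute [summit_statement] _root_.Summit.ABC.Harvest.SubexponentialSzpiro

open Literature.Abc

/-- item stmt-ABC-23394 · target · rank 0 · closed · proved by Summit.ABC.ABC.Theorems.traceDefectSubexpSzpiro_proof (prover) · by planner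
why it might fail: the constant 12 (from absorbing log⁎₂ c and the factor 4 when a is even) could need to be larger — a misstatement risk, repaired by any fixed constant; the sign restriction is essential (for b > 0 < a² − 4b, a² is the sum and rad(a) cannot be omitted: 2^k + 3^j).
sources: arXiv:2406.05083, EvertseGyory2015
[target] SUBEXPONENTIAL SZPIRO UP TO A TRACE DEFECT on the antisymmetric two-torsion class: for
every ε > 0 there is C such that for all coprime a, b with b(a² − 4b) ≠ 0, not (b > 0 and a² − 4b >
0), and every elliptic W = ⟨0,a,0,b,0⟩: log|Δ_min(W)| ≤ 12·log(1 + |a|) + C·N_W^ε. -/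
@[route_item "route-ABC-AntisymmetricTwoTorsion"]
def TraceDefectSubexpSzpiro : Prop :=
  ∀ ε : ℝ, 0 < ε → ∃ C : ℝ, ∀ a b : ℤ, IsCoprime a b → b ≠ 0 → a ^ 2 - 4 * b ≠ 0 → ¬ (0 < b ∧ 0 < a ^ 2 - 4 * b) → ∀ (W : WeierstrassCurve ℚ) [W.IsElliptic], W = ⟨0, (a : ℚ), 0, (b : ℚ), 0⟩ → Real.log (W.minimalDiscriminantNorm ℤ : ℝ) ≤ 12 * Real.log (1 + |(a : ℝ)|) + C * (W.conductorNorm ℤ : ℝ) ^ ε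

-- `TraceDefectSubexpSzpiro` holds: proved by `Summit.ABC.ABC.Theorems.traceDefectSubexpSzpiro_proof` (its module imports this route file, so no `_holds` link can be stated here).

/-- item stmt-ABC-23396 · crux · rank 3 · open · by planner
why it might fail: it is the open rung A1′ itself outside (and, for the defect, inside) a thin class; no claim; kept as the honest complement of the conjunct this line attacks.
sources: PastenShimura2024, arXiv:2504.15971
[crux] DECLARED RESIDUAL (rung-strength, NOT claimed, exempt from T3/T4): the rung A1′ given the
class theorem — i.e. subexponential Szpiro off the antisymmetric class, and on it the removal of the
trace defect 12 log(1+|a|). [deps: TraceDefectSubexpSzpiro] [difficulty: open-problem] -/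
@[route_item "route-ABC-AntisymmetricTwoTorsion", crux]
def OffClassResidual : Prop :=
  Summit.ABC.ABC.Theses.AntisymmetricTwoTorsion.TraceDefectSubexpSzpiro → Summit.ABC.Harvest.SubexponentialSzpiro

/-- item stmt-ABC-23397 · support · rank 9 · closed · proved by Summit.ABC.ABC.Theorems.pastenSepulvedaManzo2025_thm_2_2_holds (prover) · by planner
sources: arXiv:2406.05083, EvertseGyory2015
[support] ENGINE (Pasten–Sepúlveda-Manzo 2025 Thm 2.2, named fact in the tree, proved there from
Evertse–Győry Thm 4.2.1 and from rung A1.L): there is κ > 0 with log(c/a)/log⁎₂ c ≤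
exp(κ·psRate(rad(bc))) for all coprime a + b = c. [difficulty: M] -/
@[route_item "route-ABC-AntisymmetricTwoTorsion", crux]
def RadAFreeEngine : Prop :=
  Literature.NumberTheory.DiophantineGeometry.PastenSepulvedaManzo2025_thm_2_2

/-- `RadAFreeEngine` holds: proved by `Summit.ABC.ABC.Theorems.pastenSepulvedaManzo2025_thm_2_2_holds`. -/
theorem RadAFreeEngine_holds : RadAFreeEngine := _root_.Summit.ABC.ABC.Theorems.pastenSepulvedaManzo2025_thm_2_2_holds

/-- item stmt-ABC-23398 · support · rank 9 · closed · proved by Summit.ABC.ABC.Theorems.twoTorsionDictionary_proof (prover) · by planner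
sources: Silverman2009, BennettSkinner2004
[support] TWO-TORSION DICTIONARY (Tate's algorithm away from 2): for coprime a, b with b(a² − 4b) ≠
0 and W = ⟨0,a,0,b,0⟩ elliptic, |Δ_min(W)| ≤ |16 b²(a² − 4b)| and rad(b(a² − 4b)) divides 2·N_W.
[difficulty: M] -/
@[route_item "route-ABC-AntisymmetricTwoTorsion", crux]
def TwoTorsionDictionary : Prop :=
  ∀ a b : ℤ, IsCoprime a b → b ≠ 0 → a ^ 2 - 4 * b ≠ 0 → ∀ (W : WeierstrassCurve ℚ) [W.IsElliptic], W = ⟨0, (a : ℚ), 0, (b : ℚ), 0⟩ → (W.minimalDiscriminantNorm ℤ : ℝ) ≤ |(16 : ℝ) * (b : ℝ) ^ 2 * ((a : ℝ) ^ 2 - 4 * (b : ℝ))| ∧ (UniqueFactorizationMonoid.radical (b * (a ^ 2 - 4 * b))).natAbs ∣ 2 * W.conductorNorm ℤ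

-- `TwoTorsionDictionary` holds: proved by `Summit.ABC.ABC.Theorems.twoTorsionDictionary_proof` (its module imports this route file, so no `_holds` link can be stated here).

/-- item stmt-ABC-23395 · crux · rank 2 · closed · proved by Summit.ABC.ABC.Theorems.traceDefectPayoff_proof (prover) · by planner
why it might fail: bookkeeping only: psRate is not monotone near R = e^e and Thm 2.2 divides by log⁎₂ c, so the absorption constants must be tracked; if 12 is too small the target is restated with a larger absolute constant (the shape survives).
sources: arXiv:2406.05083, Silverman2009
[crux] PAYOFF: the rad(a)-free engine (Thm 2.2) and the two-torsion dictionary give the trace-defect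
bound — apply Thm 2.2 to the coprime triple with omitted member a² (a'² = a²/4 when a is even),
largest member M or M/4; absorb log⁎₂ via L ≤ 2 log|a| + E·max(1, log L) ⇒ L ≤ 4 log|a| + 4E
log(4E); exp(κ psRate(R)) ≤ C(ε) R^ε; R ≤ 2N; |Δ_min| ≤ |Δ| ≤ 64 M³; the two curves with a = 0 (b =
±1) absorbed into C. [deps: RadAFreeEngine, TwoTorsionDictionary] [difficulty: M] -/
@[route_item "route-ABC-AntisymmetricTwoTorsion", crux]
def TraceDefectPayoff : Prop :=
  Summit.ABC.ABC.Theses.AntisymmetricTwoTorsion.RadAFreeEngine → Summit.ABC.ABC.Theses.AntisymmetricTwoTorsion.TwoTorsionDictionary → Summit.ABC.ABC.Theses.AntisymmetricTwoTorsion.TraceDefectSubexpSzpiro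

-- `TraceDefectPayoff` holds: proved by `Summit.ABC.ABC.Theorems.traceDefectPayoff_proof` (its module imports this route file, so no `_holds` link can be stated here).

/-- item stmt-ABC-23399 · assembly · rank 1 · closed · proved by Summit.ABC.ABC.Theorems.antisymmetricTwoTorsion_assembly_proof (prover) · by planner
sources: PastenShimura2024
[assembly] RadAFreeEngine → TwoTorsionDictionary → TraceDefectPayoff → OffClassResidual →
SubexponentialSzpiro (rung A1′). -/
@[route_item "route-ABC-AntisymmetricTwoTorsion"]
def Assembly : Prop :=
  RadAFreeEngine → TwoTorsionDictionary → TraceDefectPayoff → OffClassResidual → Summit.ABC.Harvest.SubexponentialSzpiro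

-- `Assembly` holds: proved by `Summit.ABC.ABC.Theorems.antisymmetricTwoTorsion_assembly_proof` (its module imports this route file, so no `_holds` link can be stated here).

/-! D-0027 §2.1 — DECIDING THEOREM (planner-authored via `route open/edit --closes-file`; by planner-abc-idea-1-g2-0 2026-08-27T23:12:39Z):
its hypotheses are this route's items and its conclusion the registered leaf `Summit.ABC.Harvest.SubexponentialSzpiro` (rung ABC-A1' (PROPOSED), D-0061) (glue_lint), and it elaborates with this file. -/

@[closes "route-ABC-AntisymmetricTwoTorsion"] theorem closes (h₁ : RadAFreeEngine) (h₂ : TwoTorsionDictionary) (h₃ : TraceDefectPayoff)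
    (h₄ : OffClassResidual) : Summit.ABC.Harvest.SubexponentialSzpiro :=
  h₄ (h₃ h₁ h₂)

end Summit.ABC.ABC.Theses.AntisymmetricTwoTorsion
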